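import Mathlib
import Summits.Ventures.Crystal3D.Theorems.StickyWulffConstantStackingLiminfLayerChainV4Defs
import Summits.Ventures.Crystal3D.Theorems.StickyWulffConstantStackingLiminfMollifierSmooth
import Summits.Ventures.Crystal3D.Theorems.StickyWulffConstantStackingLiminfRungSmoothMass
import Summits.Ventures.Crystal3D.Theorems.StickyWulffConstantStackingLiminfRungEtaMass
import Summits.Ventures.Crystal3D.Theorems.StickyWulffConstantStackingLiminfKernelBounds
import Summits.Ventures.Crystal3D.Theorems.StickyWulffConstantStackingLiminfTaylorL1
import Summits.Ventures.Crystal3D.Theorems.StickyWulffConstantStackingLiminfLateralCalculus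
import HarnessLib

/-!
# S2 + lateral step of stub (B) `MollifiedUpper` (line LayerChain v4, crux `StackingLiminf`, stmt-Ventures-19145):
# per bond class, `‖−∂_b w_T + w_T − w_{T'}‖₁ ≤ ‖v_T(· − b) − v_{T'}‖₁ + #T · 64M‖b‖²/K²`

Cell `crystal3d-full`, venture `Summits/Ventures/Crystal3D`.  For a configuration `x : Fin N → ℝ³`, a set of
indices `T` (a layer) with mollified density `v_T = Σ_{i∈T} φ_K(· − x_i)` and its lateral average
`w_T = η_L ∗_∥ v_T`, and a bond vector `b` (`‖b‖ ≤ 1 ≤ K`):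
* `contDiff_layerSum`, `hasCompactSupport_layerSum`, `fderiv_layerSum_apply` — `v_T` is `C²` with compact
  support and `Dv_T(y) b = Σ_{i∈T} Dφ_K(y − x_i) b`;
* `integral_abs_classDefect_le` — `∫ |−Dv_T(y)b + v_T(y) − v_{T'}(y)| dy ≤ ∫ |v_T(y − b) − v_{T'}(y)| dy
  + #T · 64M‖b‖²/K²` (S2: the Taylor file `…TaylorL1`, p-landed, supplies the remainder bound);
* `integral_abs_lateral_classDefect_le` — the same bound for the lateral averages:
  `∫ |−Dw_T(y)b + w_T(y) − w_{T'}(y)| dy ≤ ∫ |v_T(y − b) − v_{T'}(y)| dy + #T · 64M‖b‖²/K²`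
  (`…LateralCalculus`: the derivative passes under the lateral average and `η_L ∗_∥` contracts `L¹`,
  `∫ η_L = 1` by R2 p507748).
Summed over the classes, the first terms are S1 (`sum_class_l1_le`, p512839: `≤ √2·D`) and the second add up
to `64M · 6N/K²`; this is the `T1 + T2` half of the integrated two-phase pairing.
WHAT THIS IS NOT: stub (B) (the skew term `T3` needs the bound `‖E‖₁ ≤ C(KD + N/K)`, S4); rung F-C1 not moved.
-/

noncomputable section

namespace Summit.Ventures.Crystal3D.Theorems

open MeasureTheory Set Function Metric Filter Topology
open Summit.Ventures.Crystal3D.Cruxes.StackingLiminf.LayerChainV4 (bump eta)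

variable {N : ℕ}

/-- A layer sum of bumps is `C²`. -/
theorem contDiff_layerSum (x : Fin N → EuclideanSpace ℝ (Fin 3)) (K : ℝ) (T : Finset (Fin N)) :
    ContDiff ℝ 2 (fun y : Fin 3 → ℝ => ∑ i ∈ T, bump K (y - WithLp.ofLp (x i))) :=
  ContDiff.sum fun _ _ => (contDiff_bump K).comp (contDiff_id.sub contDiff_const)

/-- A layer sum of bumps has compact support. -/
theorem hasCompactSupport_layerSum (x : Fin N → EuclideanSpace ℝ (Fin 3)) {K : ℝ} (hK : 0 < K)
    (T : Finset (Fin N)) :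
    HasCompactSupport (fun y : Fin 3 → ℝ => ∑ i ∈ T, bump K (y - WithLp.ofLp (x i))) := by
  refine HasCompactSupport.intro (isCompact_closedBall (0 : Fin 3 → ℝ) (K + ∑ i : Fin N, ‖WithLp.ofLp (x i)‖))
    fun y hy => ?_
  rw [mem_closedBall, dist_zero_right, not_le] at hy
  refine Finset.sum_eq_zero fun i _ => PlateauHeight.bump_eq_zero_of_norm hK ?_
  have h1 : ‖WithLp.ofLp (x i)‖ ≤ ∑ j : Fin N, ‖WithLp.ofLp (x j)‖ :=
    Finset.single_le_sum (fun j _ => norm_nonneg (WithLp.ofLp (x j))) (Finset.mem_univ i)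
  have h2 := norm_sub_norm_le y (WithLp.ofLp (x i))
  linarith

/-- The derivative of a layer sum, applied to a vector. -/
theorem fderiv_layerSum_apply (x : Fin N → EuclideanSpace ℝ (Fin 3)) (K : ℝ) (T : Finset (Fin N))
    (y b : Fin 3 → ℝ) :
    fderiv ℝ (fun y : Fin 3 → ℝ => ∑ i ∈ T, bump K (y - WithLp.ofLp (x i))) y b =
      ∑ i ∈ T, fderiv ℝ (bump K) (y - WithLp.ofLp (x i)) b := by
  have hterm : ∀ i ∈ T, HasFDerivAt (fun y : Fin 3 → ℝ => bump K (y - WithLp.ofLp (x i)))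
      (fderiv ℝ (bump K) (y - WithLp.ofLp (x i))) y := by
    intro i _
    have hd : HasFDerivAt (bump K) (fderiv ℝ (bump K) (y - WithLp.ofLp (x i))) (y - WithLp.ofLp (x i)) :=
      ((contDiff_bump K).differentiable (by norm_num)).differentiableAt.hasFDerivAt
    have h := hd.comp y ((hasFDerivAt_id (𝕜 := ℝ) y).sub_const (WithLp.ofLp (x i)))
    rw [ContinuousLinearMap.comp_id] at h
    exact h
  rw [(HasFDerivAt.fun_sum hterm).fderiv, _root_.sum_apply]

/-- The class defect `−Dv_T(·)b + v_T − v_{T'}` is continuous. -/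
theorem continuous_classDefect (x : Fin N → EuclideanSpace ℝ (Fin 3)) (K : ℝ) (T T' : Finset (Fin N))
    (b : Fin 3 → ℝ) :
    Continuous fun y : Fin 3 → ℝ =>
      -(fderiv ℝ (fun y : Fin 3 → ℝ => ∑ i ∈ T, bump K (y - WithLp.ofLp (x i))) y b) +
        (∑ i ∈ T, bump K (y - WithLp.ofLp (x i))) - ∑ i ∈ T', bump K (y - WithLp.ofLp (x i)) :=
  ((((contDiff_layerSum x K T).continuous_fderiv (by norm_num)).clm_apply continuous_const).neg.add
    (contDiff_layerSum x K T).continuous).sub (contDiff_layerSum x K T').continuous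

/-- The class defect has compact support. -/
theorem hasCompactSupport_classDefect (x : Fin N → EuclideanSpace ℝ (Fin 3)) {K : ℝ} (hK : 0 < K)
    (T T' : Finset (Fin N)) (b : Fin 3 → ℝ) :
    HasCompactSupport fun y : Fin 3 → ℝ =>
      -(fderiv ℝ (fun y : Fin 3 → ℝ => ∑ i ∈ T, bump K (y - WithLp.ofLp (x i))) y b) +
        (∑ i ∈ T, bump K (y - WithLp.ofLp (x i))) - ∑ i ∈ T', bump K (y - WithLp.ofLp (x i)) := by
  refine HasCompactSupport.intro (isCompact_closedBall (0 : Fin 3 → ℝ) (K + ∑ i : Fin N, ‖WithLp.ofLp (x i)‖))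
    fun y hy => ?_
  rw [mem_closedBall, dist_zero_right, not_le] at hy
  have hfar : ∀ i : Fin N, K < ‖y - WithLp.ofLp (x i)‖ := by
    intro i
    have h1 : ‖WithLp.ofLp (x i)‖ ≤ ∑ j : Fin N, ‖WithLp.ofLp (x j)‖ :=
      Finset.single_le_sum (fun j _ => norm_nonneg (WithLp.ofLp (x j))) (Finset.mem_univ i)
    have h2 := norm_sub_norm_le y (WithLp.ofLp (x i))
    linarith
  rw [fderiv_layerSum_apply, Finset.sum_eq_zero fun i _ => PlateauHeight.bump_eq_zero_of_norm hK (hfar i),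
    Finset.sum_eq_zero fun i _ => PlateauHeight.bump_eq_zero_of_norm hK (hfar i),
    Finset.sum_eq_zero fun i _ => by rw [fderiv_bump_eq_zero hK (hfar i)]; rfl]
  simp

/-- **S2 per class**: `∫ |−Dv_T(y)b + v_T(y) − v_{T'}(y)| dy ≤ ∫ |v_T(y − b) − v_{T'}(y)| dy + #T·64M‖b‖²/K²`. -/
theorem integral_abs_classDefect_le {M : ℝ} (hM0 : 0 ≤ M)
    (hM : ∀ x v : Fin 3 → ℝ, |bump 1 (x + v) - bump 1 x - fderiv ℝ (bump 1) x v| ≤ M * ‖v‖ ^ 2)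
    (x : Fin N → EuclideanSpace ℝ (Fin 3)) {K : ℝ} (hK : 1 ≤ K) (T T' : Finset (Fin N))
    {b : Fin 3 → ℝ} (hb : ‖b‖ ≤ 1) :
    ∫ y : Fin 3 → ℝ, |-(fderiv ℝ (fun y : Fin 3 → ℝ => ∑ i ∈ T, bump K (y - WithLp.ofLp (x i))) y b) +
        (∑ i ∈ T, bump K (y - WithLp.ofLp (x i))) - ∑ i ∈ T', bump K (y - WithLp.ofLp (x i))| ≤
      (∫ y : Fin 3 → ℝ, |(∑ i ∈ T, bump K (y - WithLp.ofLp (x i + WithLp.toLp 2 b))) -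
          ∑ i ∈ T', bump K (y - WithLp.ofLp (x i))|) +
        (T.card : ℝ) * (64 * M * ‖b‖ ^ 2 / K ^ 2) := by
  have hK0 : 0 < K := lt_of_lt_of_le one_pos hK
  -- the two pieces
  set S : (Fin 3 → ℝ) → ℝ := fun y => (∑ i ∈ T, bump K (y - WithLp.ofLp (x i + WithLp.toLp 2 b))) -
      ∑ i ∈ T', bump K (y - WithLp.ofLp (x i)) with hS
  set R : (Fin 3 → ℝ) → ℝ := fun y => ∑ p ∈ T.image (fun i => WithLp.ofLp (x i)),
      (bump K (y - p - b) - bump K (y - p) + fderiv ℝ (bump K) (y - p) b) with hR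
  have hinj : Set.InjOn (fun i : Fin N => WithLp.ofLp (x i)) ↑T ∨ True := Or.inr trivial
  -- rewrite the sum over the image as a sum over `T` (no injectivity needed: use sum over T directly)
  set R' : (Fin 3 → ℝ) → ℝ := fun y => ∑ i ∈ T,
      (bump K (y - WithLp.ofLp (x i) - b) - bump K (y - WithLp.ofLp (x i)) +
        fderiv ℝ (bump K) (y - WithLp.ofLp (x i)) b) with hR'
  have hpt : ∀ y : Fin 3 → ℝ,
      -(fderiv ℝ (fun y : Fin 3 → ℝ => ∑ i ∈ T, bump K (y - WithLp.ofLp (x i))) y b) +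
        (∑ i ∈ T, bump K (y - WithLp.ofLp (x i))) - ∑ i ∈ T', bump K (y - WithLp.ofLp (x i)) =
      S y - R' y := by
    intro y
    rw [fderiv_layerSum_apply, hS, hR']
    simp only [WithLp.ofLp_add, Finset.sum_add_distrib, Finset.sum_sub_distrib]
    have : ∀ i ∈ T, bump K (y - (WithLp.ofLp (x i) + b)) = bump K (y - WithLp.ofLp (x i) - b) := by
      intro i _; rw [sub_sub]
    rw [Finset.sum_congr rfl this]
    ring
  have hSi : Integrable S := by
    have h1 : Integrable fun y : Fin 3 → ℝ => ∑ i ∈ T, bump K (y - WithLp.ofLp (x i + WithLp.toLp 2 b)) :=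
      integrable_finsetSum _ fun i _ =>
        ((continuous_bump K).integrable_of_hasCompactSupport (hasCompactSupport_bump hK0)).comp_sub_right _
    have h2 : Integrable fun y : Fin 3 → ℝ => ∑ i ∈ T', bump K (y - WithLp.ofLp (x i)) :=
      integrable_finsetSum _ fun i _ =>
        ((continuous_bump K).integrable_of_hasCompactSupport (hasCompactSupport_bump hK0)).comp_sub_right _
    exact h1.sub h2
  have hR'i : Integrable R' :=
    integrable_finsetSum _ fun i _ => (integrable_taylor_bump hK0 b).comp_sub_right _
  -- per-bump Taylor bound, summed over `T`
  have hR'int : ∫ y, |R' y| ≤ (T.card : ℝ) * (64 * M * ‖b‖ ^ 2 / K ^ 2) := by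
    calc ∫ y, |R' y| ≤ ∫ y, ∑ i ∈ T, |bump K (y - WithLp.ofLp (x i) - b) - bump K (y - WithLp.ofLp (x i)) +
          fderiv ℝ (bump K) (y - WithLp.ofLp (x i)) b| :=
          integral_mono hR'i.abs (integrable_finsetSum _ fun i _ =>
            ((integrable_taylor_bump hK0 b).comp_sub_right _).abs) fun y => Finset.abs_sum_le_sum_abs _ _
      _ = ∑ i ∈ T, ∫ y, |bump K (y - WithLp.ofLp (x i) - b) - bump K (y - WithLp.ofLp (x i)) +
          fderiv ℝ (bump K) (y - WithLp.ofLp (x i)) b| :=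
          integral_finsetSum _ fun i _ => ((integrable_taylor_bump hK0 b).comp_sub_right _).abs
      _ = ∑ i ∈ T, ∫ y : Fin 3 → ℝ, |bump K (y - b) - bump K y + fderiv ℝ (bump K) y b| := by
          refine Finset.sum_congr rfl fun i _ => ?_
          exact integral_sub_right_eq_self
            (fun y => |bump K (y - b) - bump K y + fderiv ℝ (bump K) y b|) (WithLp.ofLp (x i))
      _ ≤ ∑ i ∈ T, 64 * M * ‖b‖ ^ 2 / K ^ 2 :=
          Finset.sum_le_sum fun i _ => integral_abs_taylor_bump_le hM0 hM hK hb
      _ = (T.card : ℝ) * (64 * M * ‖b‖ ^ 2 / K ^ 2) := by rw [Finset.sum_const, nsmul_eq_mul]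
  calc ∫ y : Fin 3 → ℝ, |-(fderiv ℝ (fun y : Fin 3 → ℝ => ∑ i ∈ T, bump K (y - WithLp.ofLp (x i))) y b) +
        (∑ i ∈ T, bump K (y - WithLp.ofLp (x i))) - ∑ i ∈ T', bump K (y - WithLp.ofLp (x i))|
      = ∫ y, |S y - R' y| := by simp_rw [hpt]
    _ ≤ ∫ y, (|S y| + |R' y|) :=
        integral_mono (hSi.sub hR'i).abs (hSi.abs.add hR'i.abs) fun y => abs_sub _ _
    _ = (∫ y, |S y|) + ∫ y, |R' y| := integral_add hSi.abs hR'i.abs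
    _ ≤ (∫ y, |S y|) + (T.card : ℝ) * (64 * M * ‖b‖ ^ 2 / K ^ 2) := by linarith [hR'int]

/-- **The lateral class defect is the lateral average of the class defect**: with `w_T = η_L ∗_∥ v_T`,
`−Dw_T(y)b + w_T(y) − w_{T'}(y) = ∫ η_L(z) (−Dv_T b + v_T − v_{T'})(y − ιz) dz` (the derivative passes under
the lateral average, `fderiv_lateral_apply`). -/
theorem lateral_classDefect_eq (x : Fin N → EuclideanSpace ℝ (Fin 3)) {K L : ℝ} (hK : 0 < K) (hL : 0 < L)
    (T T' : Finset (Fin N)) (b y : Fin 3 → ℝ) :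
    -(fderiv ℝ (fun y : Fin 3 → ℝ => ∫ z : ℝ × ℝ, eta L z *
          ∑ i ∈ T, bump K ((fun j => y j - (![z.1, z.2, 0] : Fin 3 → ℝ) j) - WithLp.ofLp (x i))) y b) +
      (∫ z : ℝ × ℝ, eta L z *
          ∑ i ∈ T, bump K ((fun j => y j - (![z.1, z.2, 0] : Fin 3 → ℝ) j) - WithLp.ofLp (x i))) -
      ∫ z : ℝ × ℝ, eta L z *
          ∑ i ∈ T', bump K ((fun j => y j - (![z.1, z.2, 0] : Fin 3 → ℝ) j) - WithLp.ofLp (x i)) =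
    ∫ z : ℝ × ℝ, eta L z * ((fun y' : Fin 3 → ℝ =>
      -(fderiv ℝ (fun y : Fin 3 → ℝ => ∑ i ∈ T, bump K (y - WithLp.ofLp (x i))) y' b) +
        (∑ i ∈ T, bump K (y' - WithLp.ofLp (x i))) - ∑ i ∈ T', bump K (y' - WithLp.ofLp (x i)))
      (fun j => y j - (![z.1, z.2, 0] : Fin 3 → ℝ) j)) := by
  set vT : (Fin 3 → ℝ) → ℝ := fun y => ∑ i ∈ T, bump K (y - WithLp.ofLp (x i)) with hvT
  have hηc : Continuous (eta L) := continuous_eta L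
  have hηs : HasCompactSupport (eta L) := PlateauHeight.hasCompactSupport_eta hL
  -- the derivative passes under the lateral average
  have hD : fderiv ℝ (fun y : Fin 3 → ℝ => ∫ z : ℝ × ℝ, eta L z *
      vT (fun j => y j - (![z.1, z.2, 0] : Fin 3 → ℝ) j)) y b =
      ∫ z : ℝ × ℝ, eta L z * fderiv ℝ vT (fun j => y j - (![z.1, z.2, 0] : Fin 3 → ℝ) j) b :=
    fderiv_lateral_apply (eta L) hηc hηs vT ((contDiff_layerSum x K T).of_le (by norm_num))
      (hasCompactSupport_layerSum x hK T) y b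
  have hint1 : Integrable fun z : ℝ × ℝ =>
      eta L z * fderiv ℝ vT (fun j => y j - (![z.1, z.2, 0] : Fin 3 → ℝ) j) b := by
    have hc : Continuous fun z : ℝ × ℝ => fderiv ℝ vT (fun j => y j - (![z.1, z.2, 0] : Fin 3 → ℝ) j) b :=
      (((contDiff_layerSum x K T).continuous_fderiv (by norm_num)).clm_apply continuous_const).comp
        (continuous_pi fun j => by fin_cases j <;> simp <;> fun_prop)
    exact PlateauHeight.integrable_eta_mul hL hc
  have hint2 : ∀ S : Finset (Fin N), Integrable fun z : ℝ × ℝ =>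
      eta L z * ∑ i ∈ S, bump K ((fun j => y j - (![z.1, z.2, 0] : Fin 3 → ℝ) j) - WithLp.ofLp (x i)) := by
    intro S
    have hc : Continuous fun z : ℝ × ℝ =>
        ∑ i ∈ S, bump K ((fun j => y j - (![z.1, z.2, 0] : Fin 3 → ℝ) j) - WithLp.ofLp (x i)) :=
      (contDiff_layerSum x K S).continuous.comp
        (continuous_pi fun j => by fin_cases j <;> simp <;> fun_prop)
    exact PlateauHeight.integrable_eta_mul hL hc
  have e1 : (fun y : Fin 3 → ℝ => ∫ z : ℝ × ℝ, eta L z *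
      ∑ i ∈ T, bump K ((fun j => y j - (![z.1, z.2, 0] : Fin 3 → ℝ) j) - WithLp.ofLp (x i))) =
      fun y => ∫ z : ℝ × ℝ, eta L z * vT (fun j => y j - (![z.1, z.2, 0] : Fin 3 → ℝ) j) := rfl
  have hN : Integrable fun z : ℝ × ℝ =>
      -(eta L z * fderiv ℝ vT (fun j => y j - (![z.1, z.2, 0] : Fin 3 → ℝ) j) b) := hint1.neg
  have hNA : Integrable fun z : ℝ × ℝ =>
      -(eta L z * fderiv ℝ vT (fun j => y j - (![z.1, z.2, 0] : Fin 3 → ℝ) j) b) +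
        eta L z * ∑ i ∈ T, bump K ((fun j => y j - (![z.1, z.2, 0] : Fin 3 → ℝ) j) - WithLp.ofLp (x i)) :=
    hN.add (hint2 T)
  have hsplit : (∫ z : ℝ × ℝ, eta L z * ((fun y' : Fin 3 → ℝ => -(fderiv ℝ vT y' b) +
      (∑ i ∈ T, bump K (y' - WithLp.ofLp (x i))) - ∑ i ∈ T', bump K (y' - WithLp.ofLp (x i)))
      (fun j => y j - (![z.1, z.2, 0] : Fin 3 → ℝ) j))) =
      ∫ z : ℝ × ℝ, ((-(eta L z * fderiv ℝ vT (fun j => y j - (![z.1, z.2, 0] : Fin 3 → ℝ) j) b) +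
        eta L z * ∑ i ∈ T, bump K ((fun j => y j - (![z.1, z.2, 0] : Fin 3 → ℝ) j) - WithLp.ofLp (x i))) -
        eta L z * ∑ i ∈ T', bump K ((fun j => y j - (![z.1, z.2, 0] : Fin 3 → ℝ) j) - WithLp.ofLp (x i))) :=
    integral_congr_ae (Eventually.of_forall fun z => by simp only; ring)
  rw [e1, hD]
  change _ = ∫ z : ℝ × ℝ, eta L z * ((fun y' : Fin 3 → ℝ => -(fderiv ℝ vT y' b) +
      (∑ i ∈ T, bump K (y' - WithLp.ofLp (x i))) - ∑ i ∈ T', bump K (y' - WithLp.ofLp (x i)))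
      (fun j => y j - (![z.1, z.2, 0] : Fin 3 → ℝ) j))
  rw [hsplit, integral_sub hNA (hint2 T'), integral_add hN (hint2 T), integral_neg]

/-- The lateral class defect is integrable. -/
theorem integrable_lateral_classDefect (x : Fin N → EuclideanSpace ℝ (Fin 3)) {K L : ℝ} (hK : 0 < K)
    (hL : 0 < L) (T T' : Finset (Fin N)) (b : Fin 3 → ℝ) :
    Integrable fun y : Fin 3 → ℝ =>
      -(fderiv ℝ (fun y : Fin 3 → ℝ => ∫ z : ℝ × ℝ, eta L z *
            ∑ i ∈ T, bump K ((fun j => y j - (![z.1, z.2, 0] : Fin 3 → ℝ) j) - WithLp.ofLp (x i))) y b) +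
        (∫ z : ℝ × ℝ, eta L z *
            ∑ i ∈ T, bump K ((fun j => y j - (![z.1, z.2, 0] : Fin 3 → ℝ) j) - WithLp.ofLp (x i))) -
        ∫ z : ℝ × ℝ, eta L z *
            ∑ i ∈ T', bump K ((fun j => y j - (![z.1, z.2, 0] : Fin 3 → ℝ) j) - WithLp.ofLp (x i)) := by
  have hprod := integrable_lateral_integrand (eta L) (continuous_eta L)
    (PlateauHeight.hasCompactSupport_eta hL) _ (continuous_classDefect x K T T' b)
    (hasCompactSupport_classDefect x hK T T' b)
  have h := hprod.integral_prod_left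
  refine h.congr (Eventually.of_forall fun y => ?_)
  simp only [uncurry]
  exact (lateral_classDefect_eq x hK hL T T' b y).symm

/-- **S2 per class, after lateral averaging**: with `w_T = η_L ∗_∥ v_T`,
`∫ |−Dw_T(y)b + w_T(y) − w_{T'}(y)| dy ≤ ∫ |v_T(y − b) − v_{T'}(y)| dy + #T·64M‖b‖²/K²`. -/
theorem integral_abs_lateral_classDefect_le {M : ℝ} (hM0 : 0 ≤ M)
    (hM : ∀ x v : Fin 3 → ℝ, |bump 1 (x + v) - bump 1 x - fderiv ℝ (bump 1) x v| ≤ M * ‖v‖ ^ 2)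
    (x : Fin N → EuclideanSpace ℝ (Fin 3)) {K L : ℝ} (hK : 1 ≤ K) (hL : 0 < L) (T T' : Finset (Fin N))
    {b : Fin 3 → ℝ} (hb : ‖b‖ ≤ 1) :
    ∫ y : Fin 3 → ℝ,
      |-(fderiv ℝ (fun y : Fin 3 → ℝ => ∫ z : ℝ × ℝ, eta L z *
            ∑ i ∈ T, bump K ((fun j => y j - (![z.1, z.2, 0] : Fin 3 → ℝ) j) - WithLp.ofLp (x i))) y b) +
        (∫ z : ℝ × ℝ, eta L z *
            ∑ i ∈ T, bump K ((fun j => y j - (![z.1, z.2, 0] : Fin 3 → ℝ) j) - WithLp.ofLp (x i))) -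
        ∫ z : ℝ × ℝ, eta L z *
            ∑ i ∈ T', bump K ((fun j => y j - (![z.1, z.2, 0] : Fin 3 → ℝ) j) - WithLp.ofLp (x i))| ≤
      (∫ y : Fin 3 → ℝ, |(∑ i ∈ T, bump K (y - WithLp.ofLp (x i + WithLp.toLp 2 b))) -
          ∑ i ∈ T', bump K (y - WithLp.ofLp (x i))|) +
        (T.card : ℝ) * (64 * M * ‖b‖ ^ 2 / K ^ 2) := by
  have hK0 : 0 < K := lt_of_lt_of_le one_pos hK
  simp_rw [lateral_classDefect_eq x hK0 hL T T' b]
  -- `L¹` contraction of the lateral average, `∫ |η_L| = 1`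
  have hprod := integrable_lateral_integrand (eta L) (continuous_eta L)
    (PlateauHeight.hasCompactSupport_eta hL) _ (continuous_classDefect x K T T' b)
    (hasCompactSupport_classDefect x hK0 T T' b)
  have h1 := integral_abs_lateral_le (eta L) (fun y' : Fin 3 → ℝ =>
      -(fderiv ℝ (fun y : Fin 3 → ℝ => ∑ i ∈ T, bump K (y - WithLp.ofLp (x i))) y' b) +
        (∑ i ∈ T, bump K (y' - WithLp.ofLp (x i))) - ∑ i ∈ T', bump K (y' - WithLp.ofLp (x i))) hprod
  have hη1 : ∫ z, |eta L z| = 1 := by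
    rw [show (fun z => |eta L z|) = eta L from funext fun z => abs_of_nonneg (eta_nonneg L z)]
    exact rung_integral_eta L hL
  rw [hη1, one_mul] at h1
  exact le_trans h1 (integral_abs_classDefect_le hM0 hM x hK T T' hb)

end Summit.Ventures.Crystal3D.Theorems

end
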